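import Summits.BirchSwinnertonDyer.BirchSwinnertonDyer.Theorems.PrintCFramBottomClassIndexLawFiveLeBorelUniserialLeaf
import Summits.BirchSwinnertonDyer.BirchSwinnertonDyer.Theorems.PrintCFramBottomClassIndexLawFiveLeBorelVisibilitySign
import Summits.BirchSwinnertonDyer.BirchSwinnertonDyer.Theorems.PrintCFramBottomClassIndexLawFiveLeBorelH1VanishingMachineForm
import HarnessLib

/-!
# Route `PrintCFram`, crux C2 `BottomClassIndexLawFiveLe` (stmt-BirchSwinnertonDyer-20372), line
# `eisenstein-resource-bdp-line` (S2 `stub_kolyvaginUpper_borelCM_pairSum`, input (α) over the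
# COMPOSITUM): **`H¹(F(W[p^M])/F, W[p^M]) = 0` for every number field `F ∋ √−p` with
# `(p − 1) ∤ [F : ℚ]`** — in particular over the biquadratic `F = K·K''` of the `𝓞_𝔭`-Kolyvagin
# argument, where neither the inertia route (I) nor the `√−p`-conjugation route (II) of
# `…BorelH1Vanishing` applies
# (cell `bsd-print-cfram`, seat `bsd-line-cfram-p1-w2` g5; helper `--supports` 20372; 0 facts, 0 defs)

HONEST FRAMING. Nothing about BSD is proved here, and nothing of S2 itself. Files 1–4 of this seat
proved the restriction-injectivity (α) (GJPST Prop. 5.2 / Gross Prop. 9.1) over every QUADRATIC field;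
the S2 memo runs Kolyvagin over `F = K·K'' ∋ √−p` (degree 4), where every element of `Γ_F` commutes
with `μ = √−p` and acts on `W[p]` as `a + bμ` — no element negates `√−p`, so route II is void, and
route I's inertia square lives in `Γ_ℚ`, not obviously in `res Γ_F`. ROUTE III (this file): for
`g ∈ Γ_F`, `res g = a + bμ` on `W[p]` with `a² ≡ χ̄_p(g)` (determinant on the adapted basis, the
tree's `exists_scalar_quot_of_isRationalLine` applied to the rational line `W[𝔭] = ker μ`); since
`χ̄_p(res Γ_F)` has index dividing `[F : ℚ]` in `𝔽_pˣ`, it is non-trivial as soon as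
`(p − 1) ∤ [F : ℚ]`, giving `g` with `a ≢ ±1`; then `gᵖ` acts on `W[p]` as the SCALAR `aᵖ ≡ a ≢ 1`
(`(a + bμ)ᵖ = aᵖ + p aᵖ⁻¹ b μ`, `…BorelUniserialLeaf.pow_smul_eq`), and the lift
`(gᵖ)^{p^{M−1}}` (`homothety_pow_of_level_one`) is a central homothety `d` of `W[p^M]` with
`(d − 1, p) = 1`; Sah (file 1) finishes.
* §1 `exists_restrict_cyclotomic_ne_one_of_not_dvd` (`(p−1) ∤ [F:ℚ]` ⟹ `χ̄_p ≢ 1` on `res Γ_F`),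
  `restrict_smul_sqrt_eq_of_sq_eq` (`√−p ∈ F` ⟹ `res Γ_F` fixes `√−p ∈ ℚ̄`).
* §2 `isRationalLine_ker` (`W[𝔭] = ker μ ∩ W[p]` is a rational line), `dvd_of_zsmul_eq_zero`,
  `natCast_pow_two_eq_cyclotomic_of_smul_eq` (`res g = a + bμ` on `W[p]` ⟹ `a² = χ̄_p(g)` in `𝔽_p`).
* §3 END STATES over `F ∋ √−p`, `(p−1) ∤ [F:ℚ]`, every `M ≥ 1`:
  `exists_central_homothety_of_sqrt_mem` (`∃ g₀ ∈ Γ_F, d`, `(d−1, p^M) = 1`, `g₀ = d` on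
  `W(F̄)[p^M]`), **`subgroupResKer_torsionFixing_eq_bot_of_sqrt_mem`** (`H¹(F(W[p^M])/F, W[p^M]) = 0`
  in the tree's form), `geomTorsion_eq_zero_of_forall_smul_eq_of_sqrt_mem` (`W[p^M]^{Γ_F} = 0`),
  `eq_zero_of_forall_h1Eval_eq_zero_of_sqrt_mem` (Gross Prop. 9.1 in `h1Eval` currency).
THEOREMS ONLY; no definition, no named fact, no `sorry`. BSD is not proved by any of this; no summit
statement is proved by this seat.
References: [GrigorovJorzaPatrikisSteinTarnita2009] Prop. 5.2, 5.4; [GrossLMS1991] Prop. 9.1;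
[Rubin1999] Cor. 5.5, Lemma 6.2; [SilvermanCSS1997] Ch. II §7 (det ρ̄ = χ̄).
-/

set_option autoImplicit false
-- `…BirchSwinnertonDyer.BirchSwinnertonDyer.Theorems…` is the problem's mandated namespace (D-0017).
set_option linter.dupNamespace false

noncomputable section

open scoped Classical

namespace Summit.BirchSwinnertonDyer.BirchSwinnertonDyer.Theorems.PrintCFram.BorelKolyvaginPairing

open WeierstrassCurve Field Literature.NumberTheory.EllipticCurves
  Literature.NumberTheory.EllipticCurves.KolyvaginPairing Literature.NumberTheory.GaloisRepresentations
  Literature.NumberTheory.EllipticCurves.Rank1Residual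
  Summit.BirchSwinnertonDyer.BirchSwinnertonDyer.Theorems.PrintCFram.BorelHomothety

/-! ## §1 Galois elements over a number field `F`: `χ̄_p ≢ 1` on `Γ_F`, and `Γ_F` fixes `√−p ∈ F` -/

section GaloisF

variable (p : ℕ) [hp : Fact p.Prime] (F : Type) [Field F] [NumberField F]

/-- **`χ̄_p` is non-trivial on `res Γ_F` when `(p − 1) ∤ [F : ℚ]`**: the image `χ̄_p(res Γ_F) ≤ 𝔽_pˣ`
has index dividing `[Γ_ℚ : res Γ_F] = [F : ℚ]` (`index_range_absGaloisRestrict_eq_finrank`,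
`χ̄_p : Γ_ℚ ↠ 𝔽_pˣ`), and the trivial subgroup has index `p − 1`. [folklore] -/
theorem exists_restrict_cyclotomic_ne_one_of_not_dvd (hdeg : ¬ (p - 1) ∣ Module.finrank ℚ F) :
    ∃ g : absoluteGaloisGroup F, modPCyclotomicCharacterZMod ℚ p (absGaloisRestrict ℚ F g) ≠ 1 := by
  have hpr : p.Prime := hp.out
  haveI : NeZero p := ⟨hpr.ne_zero⟩
  set φ : absoluteGaloisGroup F →* (ZMod p)ˣ :=
    (modPCyclotomicCharacterZMod ℚ p).comp (absGaloisRestrict ℚ F).toMonoidHom with hφ_def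
  by_contra hall
  push Not at hall
  have hbot : φ.range = ⊥ := by
    refine (Subgroup.eq_bot_iff_forall _).mpr ?_
    rintro _ ⟨g, rfl⟩
    exact hall g
  have hrange : φ.range = ((absGaloisRestrict ℚ F).toMonoidHom.range).map
      (modPCyclotomicCharacterZMod ℚ p) := MonoidHom.range_comp _ _
  have hidx : φ.range.index ∣ Module.finrank ℚ F := by
    rw [hrange, ← index_range_absGaloisRestrict_eq_finrank ℚ F]
    exact Subgroup.index_map_dvd _ (modPCyclotomicCharacterZMod_rat_surjective p)
  rw [hbot, Subgroup.index_bot, Nat.card_eq_fintype_card, ZMod.card_units] at hidx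
  exact hdeg hidx

omit hp in
/-- **`Γ_F` fixes `√−p` when `√−p ∈ F`.** If `y² = −p` in `F` and `s² = −p` in `ℚ̄`, then the image
of `s` in `F̄` is `± y`, fixed by every `g ∈ Γ_F`; so `res g` fixes `s`. [folklore] -/
theorem restrict_smul_sqrt_eq_of_sq_eq {y : F} (hy : y ^ 2 = -(p : F)) {s : AlgebraicClosure ℚ}
    (hs : s ^ 2 = ((-(p : ℤ) : ℤ) : AlgebraicClosure ℚ)) (g : absoluteGaloisGroup F) :
    absGaloisRestrict ℚ F g • s = s := by
  set s' : AlgebraicClosure F := absClosureEmbedding ℚ F s with hs'_def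
  have hs' : s' ^ 2 = algebraMap F (AlgebraicClosure F) (-(p : F)) := absClosureEmbedding_sq p F hs
  have hy' : (algebraMap F (AlgebraicClosure F) y) ^ 2 = algebraMap F (AlgebraicClosure F) (-(p : F)) := by
    rw [← map_pow, hy]
  have hfixy : g • algebraMap F (AlgebraicClosure F) y = algebraMap F (AlgebraicClosure F) y :=
    g.commutes y
  have hfix : g • s' = s' := by
    have h0 : (s' - algebraMap F _ y) * (s' + algebraMap F _ y) = 0 := by
      linear_combination hs' - hy'
    rcases mul_eq_zero.mp h0 with h | h
    · rw [sub_eq_zero.mp h, hfixy]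
    · rw [add_eq_zero_iff_eq_neg.mp h, smul_neg, hfixy]
  refine (absClosureEmbedding ℚ F).injective ?_
  show absClosureEmbedding ℚ F (absGaloisRestrict ℚ F g • s) = absClosureEmbedding ℚ F s
  rw [absGaloisRestrict_apply_smul]
  exact hfix

end GaloisF

/-! ## §2 The leaf: `W[𝔭] = ker μ` is a rational line, and `a² = χ̄_p` for `a + bμ ∈ ρ̄(Γ_{ℚ(√−p)})` -/

section LeafLine

variable (W : WeierstrassCurve ℚ) [W.IsElliptic] (p : ℕ) [hp : Fact p.Prime]

/-- **`W[𝔭] = ker μ ∩ W[p]` is a rational line** (order `p`, `Γ_ℚ`-stable by the sign rule).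
[cite: Rubin1999, Cor. 5.5] -/
theorem isRationalLine_ker {s : AlgebraicClosure ℚ} {μ : AddMonoid.End W.geomPoints} {m : ℤ}
    (hs : s ^ 2 = ((-(p : ℤ) : ℤ) : AlgebraicClosure ℚ)) (hm : m.natAbs = p)
    (hμμ : ∀ P, μ (μ P) = m • P)
    (hcomm : ∀ g : absoluteGaloisGroup ℚ, g • s = s → ∀ P, μ (g • P) = g • μ P)
    (hanti : ∀ g : absoluteGaloisGroup ℚ, g • s = -s → ∀ P, μ (g • P) = -(g • μ P)) :
    IsRationalLine W p ((μ : W.geomPoints →+ W.geomPoints).ker.addSubgroupOf (W.geomTorsion (p : ℤ))) := by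
  have hpr : p.Prime := hp.out
  have hle : (μ : W.geomPoints →+ W.geomPoints).ker ≤ W.geomTorsion (p : ℤ) :=
    ker_le_torsionBy (μ : W.geomPoints →+ W.geomPoints) hμμ hm
  refine ⟨?_, fun σ P hP => ?_⟩
  · rw [Nat.card_congr (AddSubgroup.addSubgroupOfEquivOfLe hle).toEquiv]
    exact natCard_ker_eq (μ : W.geomPoints →+ W.geomPoints) hμμ hm hpr
      (W.natCard_geomTorsion_prime_eq_sq hpr) (exists_mem_geomTorsion_apply_ne_zero W p hμμ hm)
  · rw [AddSubgroup.mem_addSubgroupOf] at hP ⊢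
    exact smul_mem_ker_of_mem_ker W p hs hcomm hanti σ hP

omit [W.IsElliptic] in
/-- **`k • X = 0` for `0 ≠ X ∈ W[p]` forces `p ∣ k`** (`X` has order exactly `p`). [folklore] -/
theorem dvd_of_zsmul_eq_zero {X : W.geomPoints} (hX : X ∈ W.geomTorsion (p : ℤ)) (hX0 : X ≠ 0)
    {k : ℤ} (hk : k • X = 0) : (p : ℤ) ∣ k := by
  have hpX : p • X = 0 := by rw [← natCast_zsmul]; exact hX
  have hord : addOrderOf X = p := addOrderOf_eq_prime hpX hX0
  have := (addOrderOf_dvd_iff_zsmul_eq_zero (x := X) (i := k)).mpr hk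
  rwa [hord] at this

/-- **`a² = χ̄_p(σ)` for `σ = a + bμ` on `W[p]`.** If `σ ∈ Γ_ℚ` acts on `W[p]` as `a + bμ`
(e.g. `σ` fixes `√−p`, `…BorelOStructure.smul_eq_smul_add_smul_of_comm`), then `σ` acts on the line
`W[𝔭] = μ(W[p])` AND on the quotient `W[p]/W[𝔭]` by `a`, so `a·a ≡ χ̄_p(σ)` (determinant on an
adapted basis / Weil pairing: the tree's `exists_scalar_quot_of_isRationalLine`).
[cite: SilvermanCSS1997, Ch. II §7 Proposition (det ρ̄_m = χ_m)] [cite: Rubin1999, Cor. 5.5] -/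
theorem natCast_mul_self_eq_cyclotomic_of_smul_eq {s : AlgebraicClosure ℚ}
    {μ : AddMonoid.End W.geomPoints} {m : ℤ}
    (hs : s ^ 2 = ((-(p : ℤ) : ℤ) : AlgebraicClosure ℚ)) (hm : m.natAbs = p)
    (hμμ : ∀ P, μ (μ P) = m • P)
    (hcomm : ∀ g : absoluteGaloisGroup ℚ, g • s = s → ∀ P, μ (g • P) = g • μ P)
    (hanti : ∀ g : absoluteGaloisGroup ℚ, g • s = -s → ∀ P, μ (g • P) = -(g • μ P))
    {σ : absoluteGaloisGroup ℚ} {a b : ℤ}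
    (hab : ∀ P ∈ W.geomTorsion (p : ℤ), σ • P = a • P + b • μ P) :
    ((a * a : ℤ) : ZMod p) = ((modPCyclotomicCharacterZMod ℚ p σ : (ZMod p)ˣ) : ZMod p) := by
  have hpr : p.Prime := hp.out
  set μ' : W.geomPoints →+ W.geomPoints := μ with hμ'
  obtain ⟨a', d', hline, hquot, had⟩ :=
    exists_scalar_quot_of_isRationalLine W p (isRationalLine_ker W p hs hm hμμ hcomm hanti) σ
  obtain ⟨P₀, hP₀, hμP₀⟩ := exists_mem_geomTorsion_apply_ne_zero W p hμμ hm
  have hμP₀T : μ P₀ ∈ W.geomTorsion (p : ℤ) := apply_mem_torsionBy μ' hP₀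
  have hmP₀ : m • P₀ = 0 := zsmul_eq_zero_of_natAbs_eq hP₀ hm
  -- `a ≡ a'`: both are the scalar of `σ` on `μ P₀ ∈ W[𝔭] ∖ 0`
  have haa' : (p : ℤ) ∣ a' - a := by
    have h1 : σ • μ P₀ = a • μ P₀ := by
      rw [hab _ hμP₀T, (show μ (μ P₀) = m • P₀ from hμμ P₀), hmP₀, smul_zero, add_zero]
    have h2 := congrArg (fun x : W.geomTorsion (p : ℤ) => (x : W.geomPoints))
      (hline ⟨μ P₀, hμP₀T⟩ (by
        rw [AddSubgroup.mem_addSubgroupOf, AddMonoidHom.mem_ker]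
        change μ (μ P₀) = 0
        rw [hμμ, hmP₀]))
    simp only [AddSubgroupClass.coe_zsmul] at h2
    change σ • μ P₀ = a' • μ P₀ at h2
    refine dvd_of_zsmul_eq_zero W p hμP₀T hμP₀ ?_
    rw [sub_smul, ← h2, h1, sub_self]
  -- `a ≡ d'`: `σ P₀ − d' P₀ ∈ W[𝔭]` and `σ P₀ − a P₀ = b μ P₀ ∈ W[𝔭]`
  have had' : (p : ℤ) ∣ a - d' := by
    have h3 := hquot ⟨P₀, hP₀⟩
    rw [AddSubgroup.mem_addSubgroupOf, AddMonoidHom.mem_ker] at h3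
    change μ (σ • P₀ - d' • P₀) = 0 at h3
    rw [hab _ hP₀, map_sub, map_add, map_zsmul, map_zsmul, map_zsmul, hμμ, hmP₀, smul_zero, add_zero,
      ← sub_smul] at h3
    exact dvd_of_zsmul_eq_zero W p hμP₀T hμP₀ h3
  have e1 : ((a : ℤ) : ZMod p) = a' := by
    rw [ZMod.intCast_eq_intCast_iff_dvd_sub]; exact haa'
  have e2 : ((d' : ℤ) : ZMod p) = a := by
    rw [ZMod.intCast_eq_intCast_iff_dvd_sub]; exact had'
  rw [← had, Int.cast_mul, Int.cast_mul, e2, e1]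

end LeafLine

/-! ## §3 Route III: the central homothety over every `F ∋ √−p` with `(p−1) ∤ [F:ℚ]`, every level -/

section AssemblyF

variable (W : WeierstrassCurve ℚ) [W.IsElliptic] (p : ℕ) [hp : Fact p.Prime]
  (F : Type) [Field F] [NumberField F]

/-- **Level `p` over `F`: an element of `res Γ_F` acting on `W[p]` as a scalar `≢ 1`.** For `W` CM,
`p ≥ 5` CM-ramified, `F ∋ √−p` with `(p − 1) ∤ [F : ℚ]`: some `g ∈ Γ_F` has `res(gᵖ)` acting on
`W[p]` as an integer `d ≢ 1 (mod p)` — `g` with `χ̄_p(g) ≠ 1` acts as `a + bμ` with `a² = χ̄_p(g)`,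
so `a ≢ 1`, and `(a + bμ)ᵖ = aᵖ` on `W[p]`. [cite: GrigorovJorzaPatrikisSteinTarnita2009, Prop. 5.4 (mechanism)]
[cite: Rubin1999, Cor. 5.5] -/
theorem exists_restrict_smul_eq_of_sqrt_mem (hCM : W.HasCM) (h5 : 5 ≤ p) (hram : CMRamified W p)
    (hF : ∃ y : F, y ^ 2 = -(p : F)) (hdeg : ¬ (p - 1) ∣ Module.finrank ℚ F) :
    ∃ (g : absoluteGaloisGroup F) (d : ℤ), ¬ (p : ℤ) ∣ d - 1 ∧
      ∀ P : W.geomPoints, p • P = 0 → absGaloisRestrict ℚ F g • P = d • P := by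
  have hpr : p.Prime := hp.out
  haveI : NeZero p := ⟨hpr.ne_zero⟩
  obtain ⟨y, hy⟩ := hF
  obtain ⟨s, μ, m, hs, hm, hμμ, hcomm, hanti⟩ := exists_sqrt_end_of_cmRamified W p hCM h5 hram
  have hne := exists_mem_geomTorsion_apply_ne_zero W p hμμ hm
  obtain ⟨g, hχ⟩ := exists_restrict_cyclotomic_ne_one_of_not_dvd p F hdeg
  have hgs : absGaloisRestrict ℚ F g • s = s := restrict_smul_sqrt_eq_of_sq_eq p F hy hs g
  -- `res g = a + b μ` on `W[p]`, `a² = χ̄_p(g) ≠ 1`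
  obtain ⟨a, b, hab⟩ := smul_eq_smul_add_smul_of_comm W p hμμ hm hne (M := 1) le_rfl (hcomm _ hgs)
  simp only [pow_one] at hab
  have hsq := natCast_mul_self_eq_cyclotomic_of_smul_eq W p hs hm hμμ hcomm hanti hab
  have ha1 : ((a : ℤ) : ZMod p) ≠ 1 := by
    intro h1
    apply hχ
    apply Units.ext
    rw [Units.val_one, ← hsq, Int.cast_mul, h1, mul_one]
  refine ⟨g ^ p, a ^ p, fun hdvd => ha1 ?_, fun P hP => ?_⟩
  · have h0 : ((a ^ p - 1 : ℤ) : ZMod p) = 0 := (ZMod.intCast_zmod_eq_zero_iff_dvd _ p).mpr hdvd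
    rwa [Int.cast_sub, Int.cast_pow, Int.cast_one, ZMod.pow_card, sub_eq_zero] at h0
  · have hPT : P ∈ W.geomTorsion (p : ℤ) := AddSubgroup.torsionBy.nsmul_iff.mpr hP
    have hμPT : μ P ∈ W.geomTorsion (p : ℤ) := apply_mem_torsionBy (μ : W.geomPoints →+ W.geomPoints) hPT
    have key : ∀ c : ℤ, ((p : ℤ) * c) • (μ : W.geomPoints →+ W.geomPoints) P = 0 := fun c => by
      rw [mul_smul]
      exact (W.geomTorsion (p : ℤ)).zsmul_mem hμPT c
    rw [map_pow]
    refine (pow_smul_eq (μ : W.geomPoints →+ W.geomPoints) hμμ hm (hcomm _ hgs) hab p P hPT).trans ?_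
    rw [add_eq_left, mul_assoc]
    exact key _

/-- **THE CENTRAL HOMOTHETY over `F ∋ √−p`, `(p−1) ∤ [F:ℚ]`, every level `p^M`** (route III): some
`g₀ ∈ Γ_F` acts on `W(F̄)[p^M]` as an integer `d` with `(d − 1, p^M) = 1` (`g₀ = (gᵖ)^{p^{M−1}}`).
Covers the biquadratic `F = K·K''` of the `𝓞_𝔭`-Kolyvagin argument (`[F:ℚ] = 4`, `p ≥ 7`) and
`F = ℚ(√−p)`. [cite: GrigorovJorzaPatrikisSteinTarnita2009, Prop. 5.4 (mechanism)] -/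
theorem exists_central_homothety_of_sqrt_mem (hCM : W.HasCM) (h5 : 5 ≤ p) (hram : CMRamified W p)
    (hF : ∃ y : F, y ^ 2 = -(p : F)) (hdeg : ¬ (p - 1) ∣ Module.finrank ℚ F) {M : ℕ} (hM : 1 ≤ M) :
    ∃ (g₀ : absoluteGaloisGroup F) (d : ℤ), IsCoprime (d - 1) ((p ^ M : ℕ) : ℤ) ∧
      ∀ P : geomTorsion (W.baseChange F) ((p ^ M : ℕ) : ℤ), g₀ • P = d • P := by
  obtain ⟨g, d, hd1, hg⟩ := exists_restrict_smul_eq_of_sqrt_mem W p F hCM h5 hram hF hdeg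
  obtain ⟨hcop, hpow⟩ := homothety_pow_of_level_one W p F hd1 hg hM
  exact ⟨g ^ (p ^ (M - 1)), d ^ (p ^ (M - 1)), hcop, hpow⟩

/-- **GJPST Prop. 5.2 / Gross Prop. 9.1 over `F ∋ √−p`, `(p−1) ∤ [F:ℚ]`:
`H¹(F(W[p^M])/F, W[p^M]) = 0`** (restriction `H¹(F, W[p^M]) → H¹(F(W[p^M]), W[p^M])` injective), for
every CM curve `W/ℚ` with `p ≥ 5` CM-ramified and every `M ≥ 1` — the input (α) of S2 over the
compositum `K·K''`. [cite: GrigorovJorzaPatrikisSteinTarnita2009, Prop. 5.2] [cite: Rubin1999, Lemma 6.2 (i)] -/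
theorem subgroupResKer_torsionFixing_eq_bot_of_sqrt_mem (hCM : W.HasCM) (h5 : 5 ≤ p)
    (hram : CMRamified W p) (hF : ∃ y : F, y ^ 2 = -(p : F)) (hdeg : ¬ (p - 1) ∣ Module.finrank ℚ F)
    {M : ℕ} (hM : 1 ≤ M) :
    subgroupResKer (geomTorsion (W.baseChange F) ((p ^ M : ℕ) : ℤ))
      (torsionFixing (W.baseChange F) ((p ^ M : ℕ) : ℤ)) = ⊥ := by
  obtain ⟨g₀, d, hd, hg⟩ := exists_central_homothety_of_sqrt_mem W p F hCM h5 hram hF hdeg hM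
  haveI : (W.baseChange F).IsElliptic := by unfold WeierstrassCurve.baseChange; infer_instance
  exact subgroupResKer_torsionFixing_eq_bot_of_smul_eq (W.baseChange F) (pow_ne_zero M hp.out.ne_zero)
    hg hd

/-- **`W[p^M]^{Γ_F} = 0`** over `F ∋ √−p`, `(p−1) ∤ [F:ℚ]`, every `M ≥ 1`.
[cite: GrigorovJorzaPatrikisSteinTarnita2009, Prop. 5.2] -/
theorem geomTorsion_eq_zero_of_forall_smul_eq_of_sqrt_mem (hCM : W.HasCM) (h5 : 5 ≤ p)
    (hram : CMRamified W p) (hF : ∃ y : F, y ^ 2 = -(p : F)) (hdeg : ¬ (p - 1) ∣ Module.finrank ℚ F)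
    {M : ℕ} (hM : 1 ≤ M) (P : geomTorsion (W.baseChange F) ((p ^ M : ℕ) : ℤ))
    (hP : ∀ σ : absoluteGaloisGroup F, σ • P = P) : P = 0 := by
  obtain ⟨g₀, d, hd, hg⟩ := exists_central_homothety_of_sqrt_mem W p F hCM h5 hram hF hdeg hM
  exact eq_zero_of_forall_smul_eq_of_smul_eq (W.baseChange F) hg hd P (hP g₀)

/-- **Gross Prop. 9.1 in the machine's currency over `F ∋ √−p`, `(p−1) ∤ [F:ℚ]`:** a class
`x ∈ H¹(F, W[p^M])` with `[x, ρ] = 0` for all `ρ ∈ Γ_{F(W[p^M])}` is zero. [cite: GrossLMS1991, Prop. 9.1]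
[cite: GrigorovJorzaPatrikisSteinTarnita2009, Prop. 5.2] -/
theorem eq_zero_of_forall_h1Eval_eq_zero_of_sqrt_mem (hCM : W.HasCM) (h5 : 5 ≤ p)
    (hram : CMRamified W p) (hF : ∃ y : F, y ^ 2 = -(p : F)) (hdeg : ¬ (p - 1) ∣ Module.finrank ℚ F)
    {M : ℕ} (hM : 1 ≤ M) {x : galH1Torsion (W.baseChange F) ((p ^ M : ℕ) : ℤ)}
    (hx : ∀ ρ ∈ torsionFixing (W.baseChange F) ((p ^ M : ℕ) : ℤ),
      h1Eval (W.baseChange F) ((p ^ M : ℕ) : ℤ) x ρ = 0) : x = 0 := by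
  obtain ⟨g₀, d, hd, hg⟩ := exists_central_homothety_of_sqrt_mem W p F hCM h5 hram hF hdeg hM
  haveI : (W.baseChange F).IsElliptic := by unfold WeierstrassCurve.baseChange; infer_instance
  exact eq_zero_of_h1Eval_eq_zero_of_smul_eq (W.baseChange F) (pow_ne_zero M hp.out.ne_zero) hg hd hx

end AssemblyF

end Summit.BirchSwinnertonDyer.BirchSwinnertonDyer.Theorems.PrintCFram.BorelKolyvaginPairing

end
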